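import Summits.BirchSwinnertonDyer.BirchSwinnertonDyer.Theorems.TwinTransportX9FrameSupply
import Summits.BirchSwinnertonDyer.BirchSwinnertonDyer.Theorems.TwinTransportX9HeartReduction
import Summits.BirchSwinnertonDyer.BirchSwinnertonDyer.Theorems.TwinTransportX9ParityLaw
import Literature.NumberTheory.EllipticCurves.NonvanishingTwistsAdmissibleFieldOfFriedbergHoffsteinProofs
import Literature.NumberTheory.EllipticCurves.Rank1Residual.X10Proofs

/-!
# Route `TwinTransportX9` — crux `TrivialTwinSupplyX9` (item 24080): the ANALYTIC-RANK HALF of the unit-twin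
supply, CLASS-WIDE, from Friedberg–Hoffstein

The crux asks, at every X9 pair `(W, p)` with `p ∤ ∏ c_ℓ(W)`, for an admissible frame (or two admissible steps)
reaching a globally minimal twin of ANALYTIC RANK `0` whose value `L/Ω` is a `p`-adic unit and whose `Ш` is prime
to `p`. After `TwinTransportX9FrameSupply` (frames exist), `…HeartReduction` (ClassX9 / Tamagawa / torsion travel
along every frame) and `…ParityLaw` (odd pairs use one step, even pairs two), this file closes the ANALYTIC-RANK
conjunct class-wide, from the named fact `friedbergHoffstein_exists_heegnerField_splitDivisors_twist_ne_zero`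
(Friedberg–Hoffstein 1995 Thm. B (1), finite-set form as used by Jetchev–Skinner–Wan 2017 §7.4) and Modularity:

* `exists_admissibleTwin_analyticRank_zero` — for every globally minimal elliptic `W` with `w(W) = -1`, prime
  `p ≥ 5` with `p ∤ N(W)` and bound `n`: a BCS-admissible pair `(d_K, d_F)` with `d_K < -n < n < d_F` and a
  globally minimal `W₁`, `C • W₁ = W^{(d_K)}`, with `r_an(W₁) = 0`. (Friedberg–Hoffstein supplies `d_K < 0`
  fundamental, `≡ 1 (mod 8)`, split at `p` and at every `ℓ ∣ N`, with `L(W^{(d_K)}, 1) ≠ 0`; the `F`-side is the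
  Literature's Lemma 5.2.3 `exists_auxiliaryRealQuadraticDiscr`, as in `exists_bcsAdmissiblePair`.)
* `oddPair_admissibleTwin_analyticRank_zero` — at every X9 pair of ODD analytic rank with `p ∤ ∏ c_ℓ(W)`: an
  admissible frame and minimal twin `W₁` with `r_an(W₁) = 0 ∧ ClassX9 W₁ p ∧ p ∤ ∏ c_ℓ(W₁) ∧ p ∤ #tors(W₁)` —
  the FIRST DISJUNCT of the crux body with exactly the two clauses `L(W₁,1)/Ω ∈ ℤ_(p)^×` and `p ∤ #Ш(W₁)` removed.
* `evenPair_admissibleTwin₂_analyticRank_zero` — at every X9 pair of EVEN analytic rank with `p ∤ ∏ c_ℓ(W)`: two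
  admissible steps `W ↦ W₁ ↦ W₂` with `r_an(W₂) = 0 ∧ ClassX9 W₂ p ∧ p ∤ ∏ c_ℓ(W₂) ∧ p ∤ #tors(W₂)` — the SECOND
  DISJUNCT with the same two clauses removed (first step: any admissible frame, `w` flips to `-1`; second step:
  Friedberg–Hoffstein for `W₁`).

So, modulo Friedberg–Hoffstein + Modularity (print theorems, binders `hFH`, `hmod`), what remains of
`TrivialTwinSupplyX9` per pair is ONLY: among the (infinitely many) admissible analytic-rank-`0` twins, one with
`L/Ω` a `p`-adic UNIT (Prasanna 2010 p. 400: non-vanishing mod `p`, beyond (sur)/(im)) and `p ∤ #Ш` (S2).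
HONEST FRAMING: BSD is NOT proved; the crux is NOT proved. Helper theorems (`--supports` item 24080);
0 definitions, 0 new named facts, 0 sorry. References: [FriedbergHoffstein1995] Thm. B (1); [JetchevSkinnerWan2017]
§7.4.1–7.4.2; [BurungaleCastellaSkinner2025] §1.2, Lemma 5.2.3; [Darmon2004] §3.6, §3.9; [Prasanna2010CJM] p. 400.
-/

set_option linter.dupNamespace false
set_option autoImplicit false

noncomputable section

open scoped Classical NumberField

open WeierstrassCurve Literature.NumberTheory.EllipticCurves
  Literature.NumberTheory.EllipticCurves.ModularForms
  Summit.BirchSwinnertonDyer.BirchSwinnertonDyer.Rank1Residual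
  Summit.BirchSwinnertonDyer.BirchSwinnertonDyer.Theses.TwinTransportX9
  Literature.NumberTheory.QuadraticFields.Quadratic

namespace Summit.BirchSwinnertonDyer.BirchSwinnertonDyer.Theorems.TwinTransportX9Rung

/-! ## §1 An admissible analytic-rank-0 twin for every curve of root number −1 (Friedberg–Hoffstein) -/

/-- **Admissible analytic-rank-`0` twins exist (beyond any bound) for every `W` with `w(W) = -1`**, `p ≥ 5`,
`p ∤ N(W)`: Friedberg–Hoffstein (finite-set form, `S = {p}`) gives a fundamental `d_K < -n`, `d_K ≡ 1 (mod 8)`,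
split at `p` and at every `ℓ ∣ N(W)`, with `L(W^{(d_K)}, 1) ≠ 0`; this is the `K`-side of a BCS-admissible pair
((disc)/(Heeg)/(spl)), the `F`-side is Lemma 5.2.3 (`exists_auxiliaryRealQuadraticDiscr`), and the minimal model
`W₁` of `W^{(d_K)}` (Néron) has `r_an(W₁) = 0`. BSD is NOT proved.
[cite: FriedbergHoffstein1995, Thm. B (1)] [cite: JetchevSkinnerWan2017, §7.4.1–7.4.2]
[cite: BurungaleCastellaSkinner2025, §1.2, Lemma 5.2.3] -/
theorem exists_admissibleTwin_analyticRank_zero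
    (hFH : friedbergHoffstein_exists_heegnerField_splitDivisors_twist_ne_zero)
    (W : WeierstrassCurve ℚ) [W.IsElliptic] [W.IsGloballyMinimal]
    {p : ℕ} (hp : p.Prime) (hp5 : 5 ≤ p) (hpN : ¬ p ∣ W.conductorNorm ℤ) (hw : W.rootNumber = -1) (n : ℕ) :
    ∃ dK dF : ℤ, BCSAdmissiblePair W p dK dF ∧ dK < -(n : ℤ) ∧ (n : ℤ) < dF ∧
      ∃ (W₁ : WeierstrassCurve ℚ) (_ : W₁.IsElliptic) (_ : W₁.IsGloballyMinimal),
        (∃ C : WeierstrassCurve.VariableChange ℚ, C • W₁ = W.quadraticTwist (dK : ℚ)) ∧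
        W₁.analyticRank = 0 := by
  have hp2 : p ≠ 2 := by omega
  have hN0 : W.conductorNorm ℤ ≠ 0 := fun h => hpN (by rw [h]; exact dvd_zero p)
  -- Step 1 (Friedberg–Hoffstein): the `K`-side with a non-vanishing twisted central value
  obtain ⟨d, hd0, hdsq, hd8, hdn, hS, hSN, hL⟩ :=
    exists_neg_fundamental_twist_ne_zero_of_friedbergHoffstein hFH W hw {p} (n + 3)
  have hHeeg : ∀ ℓ : ℕ, ℓ.Prime → ℓ ∣ W.conductorNorm ℤ → SplitsInQuadField d ℓ := by
    intro ℓ hℓ hℓN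
    by_cases hℓ2 : ℓ = 2
    · subst hℓ2; exact splitsInQuadField_two_iff.mpr hd8
    · exact (splitsInQuadField_iff_jacobiSym_eq_one hℓ hℓ2).mpr (hSN ℓ hℓ hℓN hℓ2)
  have hspl : SplitsInQuadField d p :=
    (splitsInQuadField_iff_jacobiSym_eq_one hp hp2).mpr (hS p (Finset.mem_singleton_self p) hp hp2)
  have hdisc : d < 0 ∧ Squarefree d ∧ d % 4 = 1 ∧ d ≠ -3 := ⟨hd0, hdsq, by omega, by omega⟩
  -- split primes are unramified: `d` is prime to `2 p N(W)`
  have hcop : d.natAbs.Coprime (2 * p * W.conductorNorm ℤ) := by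
    refine Nat.coprime_of_dvd fun k hk hkd hkM => ?_
    have hkd' : (k : ℤ) ∣ d := Int.natCast_dvd.mpr hkd
    rcases (Nat.Prime.dvd_mul hk).mp hkM with hk2p | hkN
    · rcases (Nat.Prime.dvd_mul hk).mp hk2p with hk2 | hkp
      · obtain rfl : k = 2 := (Nat.prime_dvd_prime_iff_eq hk Nat.prime_two).mp hk2
        have h2 : (2 : ℤ) ∣ d := by exact_mod_cast hkd'
        omega
      · obtain rfl : k = p := (Nat.prime_dvd_prime_iff_eq hk hp).mp hkp
        exact hspl.1 hkd'
    · exact (hHeeg k hk hkN).1 hkd'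
  -- Step 2: the `F`-side by the Literature's Lemma 5.2.3, at `M = N(W)`
  obtain ⟨dF, hXF, hF1, hF4, hFsq, hFp, hFii, hFiii, hFvi⟩ :=
    exists_auxiliaryRealQuadraticDiscr p hp hp5 (W.conductorNorm ℤ) hN0 hpN d hd0.ne hcop
      (Finset.Icc (-(n : ℤ)) n)
  have hnF : (n : ℤ) < dF := by
    by_contra h
    exact hXF (Finset.mem_Icc.mpr ⟨by omega, by omega⟩)
  have hi : InertInQuadField dF p := (inertInQuadField_iff_jacobiSym_eq_neg_one hp hp2).mpr hFp
  have hii : ∀ ℓ : ℕ, ℓ.Prime → (ℓ : ℤ) ∣ dF → SplitsInQuadField d ℓ := by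
    intro ℓ hℓ hℓd
    obtain ⟨h2, hodd⟩ := hFii ℓ hℓ hℓd
    by_cases hℓ2 : ℓ = 2
    · subst hℓ2; exact splitsInQuadField_two_iff.mpr (h2 rfl)
    · exact (splitsInQuadField_iff_jacobiSym_eq_one hℓ hℓ2).mpr (hodd hℓ2)
  have hiii : ∀ ℓ : ℕ, ℓ.Prime → ℓ ∣ W.conductorNorm ℤ →
      (p ∣ ℓ + 1 → InertInQuadField dF ℓ) ∧ (¬ p ∣ ℓ + 1 → SplitsInQuadField dF ℓ) := by
    intro ℓ hℓ hℓN
    obtain ⟨hin, hsp⟩ := hFiii ℓ hℓ hℓN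
    by_cases hℓ2 : ℓ = 2
    · subst hℓ2
      exact ⟨fun h => inertInQuadField_two_iff.mpr ((hin h).1 rfl),
        fun h => splitsInQuadField_two_iff.mpr ((hsp h).1 rfl)⟩
    · exact ⟨fun h => (inertInQuadField_iff_jacobiSym_eq_neg_one hℓ hℓ2).mpr ((hin h).2 hℓ2),
        fun h => (splitsInQuadField_iff_jacobiSym_eq_one hℓ hℓ2).mpr ((hsp h).2 hℓ2)⟩
  have hadm : BCSAdmissiblePair W p d dF := ⟨hdisc, hHeeg, hspl, ⟨hF1, hFsq, hF4⟩, hi, hii, hiii, hFvi⟩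
  -- Step 3: the minimal model of the twist has analytic rank 0
  have hdQ : (d : ℚ) ≠ 0 := by exact_mod_cast hd0.ne
  haveI iT : (W.quadraticTwist (d : ℚ)).IsElliptic := isElliptic_quadraticTwist _ hdQ
  obtain ⟨C, hC⟩ := hasGlobalMinimalModel_rat_holds (W.quadraticTwist (d : ℚ))
  haveI := hC
  have hCW : C⁻¹ • (C • W.quadraticTwist (d : ℚ)) = W.quadraticTwist (d : ℚ) := inv_smul_smul C _
  have hr : (C • W.quadraticTwist (d : ℚ)).analyticRank = 0 := by
    rw [WeierstrassCurve.analyticRank_smul]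
    exact Literature.NumberTheory.EllipticCurves.Rank1Residual.analyticRank_eq_zero_of_entireLFunction_one_ne_zero hL
  have hnK : d < -(n : ℤ) := by
    have : (n + 3 : ℕ) < d.natAbs := hdn
    omega
  exact ⟨d, dF, hadm, hnK, hnF, C • W.quadraticTwist (d : ℚ), inferInstance, hC, ⟨C⁻¹, hCW⟩, hr⟩

/-! ## §2 Odd X9 pairs: the first disjunct minus (unit value, `p ∤ Ш`), class-wide -/

/-- **At every X9 pair of ODD analytic rank with `p ∤ ∏ c_ℓ(W)`: an admissible frame whose minimal twin has
`r_an(W₁) = 0`, `ClassX9 W₁ p`, `p ∤ ∏ c_ℓ(W₁)`, `p ∤ #W₁(ℚ)_tors`** — the first disjunct of the crux body with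
exactly the clauses "`L(W₁,1)/Ω(W₁)` a `p`-adic unit" and "`p ∤ #Ш(W₁)`" removed (beyond any bound `n`). From
Friedberg–Hoffstein (`hFH`) and Modularity (`hmod`: `w(W) = (-1)^{r_an} = -1`). BSD is NOT proved; the crux is
NOT proved. [cite: FriedbergHoffstein1995, Thm. B (1)] [cite: JetchevSkinnerWan2017, §7.4.1–7.4.2]
[cite: BurungaleCastellaSkinner2025, §1.2, Prop. 5.2.1] [cite: Prasanna2010CJM, p. 400 (Introduction)] -/
theorem oddPair_admissibleTwin_analyticRank_zero
    (hFH : friedbergHoffstein_exists_heegnerField_splitDivisors_twist_ne_zero) (hmod : exists_isNewformOf)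
    (W : WeierstrassCurve ℚ) [W.IsElliptic] [W.IsGloballyMinimal] (p : ℕ) [Fact p.Prime]
    (hX9 : ClassX9 W p) (hTam : ¬ p ∣ W.tamagawaProduct) (hodd : Odd W.analyticRank) (n : ℕ) :
    ∃ dK dF : ℤ, BCSAdmissiblePair W p dK dF ∧ dK < -(n : ℤ) ∧ (n : ℤ) < dF ∧
      ∃ (W₁ : WeierstrassCurve ℚ) (_ : W₁.IsElliptic) (_ : W₁.IsGloballyMinimal),
        (∃ C : WeierstrassCurve.VariableChange ℚ, C • W₁ = W.quadraticTwist (dK : ℚ)) ∧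
        W₁.analyticRank = 0 ∧ ClassX9 W₁ p ∧ ¬ p ∣ W₁.tamagawaProduct ∧ ¬ p ∣ W₁.torsionOrder := by
  have hp : p.Prime := Fact.out
  have hw : W.rootNumber = -1 := by
    rw [WeierstrassCurve.rootNumber_eq_neg_one_pow_analyticRank_of_exists_isNewformOf hmod W]
    exact hodd.neg_one_pow
  obtain ⟨dK, dF, hadm, hnK, hnF, W₁, i₁, i₁', ⟨C, hC⟩, hr⟩ :=
    exists_admissibleTwin_analyticRank_zero hFH W hp hX9.2.1
      (not_dvd_conductorNorm_of_hasGoodReductionAtPrime W hX9.2.2.1) hw n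
  haveI := i₁; haveI := i₁'
  exact ⟨dK, dF, hadm, hnK, hnF, W₁, i₁, i₁', ⟨C, hC⟩, hr, frameTransport_classX9 W p hX9 hTam hadm W₁ hC⟩

/-! ## §3 Even X9 pairs: the second disjunct minus (unit value, `p ∤ Ш`), class-wide -/

/-- **At every X9 pair of EVEN analytic rank with `p ∤ ∏ c_ℓ(W)`: two admissible steps `W ↦ W₁ ↦ W₂` whose end
has `r_an(W₂) = 0`, `ClassX9 W₂ p`, `p ∤ ∏ c_ℓ(W₂)`, `p ∤ #W₂(ℚ)_tors`** — the second disjunct of the crux body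
with exactly the clauses "`L(W₂,1)/Ω(W₂)` a `p`-adic unit" and "`p ∤ #Ш(W₂)`" removed (second frame beyond any
bound). First step: any admissible frame (`exists_bcsAdmissiblePair_of_classX9`), along which `w` flips to `-1`
(`rootNumber_twin_eq_neg`); second step: Friedberg–Hoffstein for `W₁` (`p ∤ N(W₁)` by good reduction, class X9
travels). BSD is NOT proved; the crux is NOT proved. [cite: FriedbergHoffstein1995, Thm. B (1)]
[cite: Darmon2004, §3.6 Thm. 3.15 and p. 39] [cite: BurungaleCastellaSkinner2025, §1.2, Prop. 5.2.1, Lemma 5.2.3] -/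
theorem evenPair_admissibleTwin₂_analyticRank_zero
    (hFH : friedbergHoffstein_exists_heegnerField_splitDivisors_twist_ne_zero) (hmod : exists_isNewformOf)
    (W : WeierstrassCurve ℚ) [W.IsElliptic] [W.IsGloballyMinimal] (p : ℕ) [Fact p.Prime]
    (hX9 : ClassX9 W p) (hTam : ¬ p ∣ W.tamagawaProduct) (heven : Even W.analyticRank) (n : ℕ) :
    ∃ dK dF : ℤ, BCSAdmissiblePair W p dK dF ∧
      ∃ (W₁ : WeierstrassCurve ℚ) (_ : W₁.IsElliptic) (_ : W₁.IsGloballyMinimal),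
        (∃ C : WeierstrassCurve.VariableChange ℚ, C • W₁ = W.quadraticTwist (dK : ℚ)) ∧
        ∃ dK' dF' : ℤ, BCSAdmissiblePair W₁ p dK' dF' ∧ dK' < -(n : ℤ) ∧ (n : ℤ) < dF' ∧
          ∃ (W₂ : WeierstrassCurve ℚ) (_ : W₂.IsElliptic) (_ : W₂.IsGloballyMinimal),
            (∃ C : WeierstrassCurve.VariableChange ℚ, C • W₂ = W₁.quadraticTwist (dK' : ℚ)) ∧
            W₂.analyticRank = 0 ∧ ClassX9 W₂ p ∧ ¬ p ∣ W₂.tamagawaProduct ∧ ¬ p ∣ W₂.torsionOrder := by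
  have hp : p.Prime := Fact.out
  -- first step: any admissible frame; class X9 and `p ∤ ∏ c_ℓ` travel, the root number flips
  obtain ⟨dK, dF, hadm, -, -, -⟩ := exists_bcsAdmissiblePair_of_classX9 W p hX9 0
  obtain ⟨W₁, i₁, i₁', ⟨C, hC⟩, hX9₁, hTam₁, -⟩ := frameTwin_classX9 W p hX9 hTam hadm
  haveI := i₁; haveI := i₁'
  have hw1 : W₁.rootNumber = -1 := by
    rw [rootNumber_twin_eq_neg hmod W hadm W₁ hC,
      WeierstrassCurve.rootNumber_eq_neg_one_pow_analyticRank_of_exists_isNewformOf hmod W, heven.neg_one_pow]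
  -- second step: Friedberg–Hoffstein for `W₁`
  obtain ⟨dK', dF', hadm', hnK, hnF, W₂, i₂, i₂', ⟨C', hC'⟩, hr⟩ :=
    exists_admissibleTwin_analyticRank_zero hFH W₁ hp hX9₁.2.1
      (not_dvd_conductorNorm_of_hasGoodReductionAtPrime W₁ hX9₁.2.2.1) hw1 n
  haveI := i₂; haveI := i₂'
  exact ⟨dK, dF, hadm, W₁, i₁, i₁', ⟨C, hC⟩, dK', dF', hadm', hnK, hnF, W₂, i₂, i₂', ⟨C', hC'⟩, hr,
    frameTransport_classX9 W₁ p hX9₁ hTam₁ hadm' W₂ hC'⟩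

end Summit.BirchSwinnertonDyer.BirchSwinnertonDyer.Theorems.TwinTransportX9Rung
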